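import Literature.Barriers.CriticalPhenomena.PlaquetteWalkHoleRootHoleColumnWestLeg
import HarnessLib

/-!
# Barrier catalogue (SAWScalingLimit): in the HOLE COLUMN the excursion of the straight level-`7` member first runs THE LOOP UNDER THE HOLE («HOLE COLUMN: THE LOOP»)

`Z → ∞` limit model of the printed Yang–Baxter weights [GlazmanManolescu2019, §1, eq. (1)]; the «RECTANGLE COEFFICIENT» line (b-engine-1 g29), the frame of the
HOLE-COLUMN programme (FINDING-YB-HOLE-COLUMN-FOUR-PHASE; DESIGN-next b-engine-1 g28 §6 (a3), §7). In the setting of `ΩG.westLeg_of_cost_seven_straight_holeColumn_above`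
(a wound class-`B2a` walk of limit cost `7` from the hole root, slanted end, straight first arc at a hole-column rhombus `r = (w.1 − 1, r.2)` strictly above the hole,
an arc above the row of `r`; seven isolated turns `T = (r.1, Y)`, `t₂`, `b_W = (r.1 − MW, Y')`, `b₂`, `τ`, `e_W = (r.1 − MW, r.2)`, `e_E`; the west turn goes down):

* ★★★ `ΩG.loop_of_cost_seven_straight_holeColumn_above`: the second bottom turn is `b_E = (k₀, Y')` with `k₀ ≥ w.1 + k₁` at or east of the first turning plaquette
  `p₁ = (w.1 + k₁, w.2)` of the walk, and THE EXCURSION IS PINNED FROM THE FIRST HIT TO THE ROOT ROW: `r` is crossed `E → W`; then the `W`-chain of `r` westwards to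
  `e_W`; DOWN the column `r.1 − MW` through the root row west of the hole to `b_W`; EAST along the bottom row, under the hole, to `b_E`; UP the column `k₀`, across
  the eastern ray of the hole, into the root-row plaquette `q = (k₀, w.2)`, entered from `S` at the index `F + MW + (r.2 − Y') + (k₀ − r.1 + MW) + (w.2 − Y')`.
  WHY: the excursion meets the eastern ray from below at some `q = (k, w.2)`, `k ≥ w.1 + k₁` (`ΩG.exists_tail_arc_rootRow_S_beyond_prefix`, the even–odd rule); the
  `S`-chain of `q` ends at a bottom turn, which is not `b_W` (west of the hole), so it is the other one, `(k, Y')`; `b_E` does not use `E` (its `E`-chain would need a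
  third bottom turn) and its `W`-chain ends at `b_W`; if the excursion arc LEFT `q` downwards, following it down, west and up the west leg would bring the walk into
  `e_W` from `S` and on eastwards into `r` a second time — so it ENTERS `q` from below, and reading backwards (down `k₀`, west along the bottom row, up the west leg
  into `e_W`, east along the row of `r`) lands at the unique visit of `r`, the first hit.

[GlazmanManolescu2019 §1 Fig. 1, eq. (1), Lemma 2.1, Remark 2.2; Glazman2015WeightedSAW Lemma 3.1 (proof, pp. 6–7); CourantRobbins1958 Ch. V App. §2 (the even–odd rule)]
-/

noncomputable section

namespace Literature.Probability.RandomPlanarGeometry.SAW.YangBaxter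

open Real
open Literature.Barriers.CriticalPhenomena.PlaquetteWalk

open private fc_fh fh_add_Mv three_le_Mv from Literature.Probability.RandomPlanarGeometry.YangBaxterSAWGeneralDomain
open private fc_sOut_pred_of_sIn_S fc_sOut_pred_of_sIn_N from Literature.Barriers.CriticalPhenomena.PlaquetteWalkStraightRuns
open private sIn_succ_eq_S sIn_succ_eq_N from Literature.Barriers.CriticalPhenomena.PlaquetteWalkKissChains

namespace ΩG

variable {D : Set Face} {w r : Face} {ω : ΩG D (w.side .W) r}

/-- ★★★ **HOLE COLUMN: THE LOOP UNDER THE HOLE.** Let `ω` be a wound class-`B2a` walk of limit cost `7` from the hole root `w.side W` (hole `(w.1 − 1, w.2)` absent) with a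
slanted end and a STRAIGHT first arc at a rhombus `r` of the hole column (`r.1 = w.1 − 1`) strictly above the hole, some arc of `ω` lying strictly above the row of `r`.
Then, with the data of `westLeg_of_cost_seven_straight_holeColumn_above` (top row `Y`, bottom row `Y'`, `τ = (τ1, w.2)`, `e_W = (r.1 − MW, r.2)`, `e_E = (r.1 + ME, r.2)`,
the second top turn `t₂`) and the index `k₁ ≤ F` of the first turning arc (the arcs before it straight, `fc k₁ = (w.1 + k₁, w.2)` entered from `W`): the seven isolated
turns are `T = (r.1, Y)`, `t₂`, `b_W = (r.1 − MW, Y')`, `b_E = (k₀, Y')` with `w.1 + k₁ ≤ k₀`, `τ`, `e_W`, `e_E`; and the arcs `F, F + 1, …, i₀`,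
`i₀ = F + MW + (r.2 − Y') + (k₀ − (r.1 − MW)) + (w.2 − Y') < n`, are: `r` crossed `E → W`; the plaquettes `(r.1 − m, r.2)`, `m ≤ MW`, entered from `E`; the column
`(r.1 − MW, r.2 − m)`, `1 ≤ m ≤ r.2 − Y'`, entered from `N`; the bottom row `(r.1 − MW + m, Y')`, `1 ≤ m ≤ k₀ − (r.1 − MW)`, entered from `W`; the column `(k₀, Y' + m)`,
`1 ≤ m ≤ w.2 − Y'`, entered from `S` — ending in the root-row plaquette `(k₀, w.2)` entered from `S`. Moreover no bottom-row plaquette uses `S`, `b_W` does not use `W`,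
and `b_E` uses neither `E` nor `S`. [cite: GlazmanManolescu2019, §1, Fig. 1 and eq. (1); Lemma 2.1; Remark 2.2] [cite: Glazman2015WeightedSAW, Lemma 3.1 (proof, pp. 6–7)]
[cite: CourantRobbins1958, Ch. V Appendix §2 (the even–odd rule)] -/
theorem loop_of_cost_seven_straight_holeColumn_above (hh : holeFaceW w ∉ D) (hr : RootedFace D (w.side .W) r) (h : ω.IsB2a)
    (hA : ω.AJ hr h (toC (midPt (w.side .W))) ≠ 0) (hc : cost (slotOfSide ω.1) ω.2.mids = 7) (hz : ω.1 = .N ∨ ω.1 = .S)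
    (hstr8 : arcKind (ω.2.sIn ω.2.firstHitG) (ω.2.sOut ω.2.firstHitG) = .straight) (hcol : r.1 = w.1 - 1) (habove : w.2 < r.2)
    (hup : ∃ j < ω.2.arcs.length, r.2 < (ω.2.fc j).2) :
    ∃ (Y Y' τ1 k₀ : ℤ) (MW ME k₁ : ℕ) (t₂ : Face),
      (∀ j < ω.2.arcs.length, (ω.2.fc j).2 ≤ Y) ∧ (∀ j < ω.2.arcs.length, Y' ≤ (ω.2.fc j).2) ∧ r.2 < Y ∧ Y' < w.2 ∧
      t₂.2 = Y ∧ t₂.1 ≠ r.1 ∧ w.1 ≤ τ1 ∧ 1 ≤ MW ∧ 1 ≤ ME ∧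
      (∀ m : ℕ, 1 ≤ m → m ≤ MW → ω.2.UsesSide (r.1 - m, r.2) .E) ∧ (∀ m : ℕ, m < MW → ω.2.UsesSide (r.1 - m, r.2) .W) ∧
        ¬ω.2.UsesSide (r.1 - MW, r.2) .W ∧
      (∀ m : ℕ, 1 ≤ m → m ≤ ME → ω.2.UsesSide (r.1 + m, r.2) .W) ∧ (∀ m : ℕ, m < ME → ω.2.UsesSide (r.1 + m, r.2) .E) ∧
        ¬ω.2.UsesSide (r.1 + ME, r.2) .E ∧
      (∀ f ∈ ({((r.1 : ℤ), Y), t₂, ((r.1 : ℤ) - MW, Y'), (k₀, Y'), ((τ1 : ℤ), w.2), ((r.1 : ℤ) - MW, r.2), ((r.1 : ℤ) + ME, r.2)} : Finset Face),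
        f ∈ facesL ω.2.mids ∧ (kindsL ω.2.mids f = [.corner] ∨ kindsL ω.2.mids f = [.coCorner])) ∧
      (∀ f : Face, f ∈ facesL ω.2.mids → (kindsL ω.2.mids f = [.corner] ∨ kindsL ω.2.mids f = [.coCorner]) →
        f ∈ ({((r.1 : ℤ), Y), t₂, ((r.1 : ℤ) - MW, Y'), (k₀, Y'), ((τ1 : ℤ), w.2), ((r.1 : ℤ) - MW, r.2), ((r.1 : ℤ) + ME, r.2)} : Finset Face)) ∧
      ω.1 = .N ∧ ω.2.fc (ω.2.arcs.length - 1) = (r.1, r.2 + 1) ∧ ω.2.sOut (ω.2.arcs.length - 1) = .S ∧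
      (∀ m : ℕ, (m : ℤ) ≤ Y - r.2 - 1 → ω.2.fc (ω.2.arcs.length - 1 - m) = (r.1, r.2 + 1 + m)) ∧
      (∀ m : ℕ, (m : ℤ) < Y - r.2 - 1 → ω.2.sIn (ω.2.arcs.length - 1 - m) = .N) ∧
      ω.2.UsesSide (r.1 - MW, r.2) .S ∧ ¬ω.2.UsesSide (r.1 - MW, r.2) .N ∧
      (∀ m : ℕ, 1 ≤ m → (m : ℤ) ≤ r.2 - Y' → ω.2.UsesSide (r.1 - MW, r.2 - m) .N) ∧
      (∀ m : ℕ, (m : ℤ) < r.2 - Y' → ω.2.UsesSide (r.1 - MW, r.2 - m) .S) ∧ ¬ω.2.UsesSide (r.1 - MW, Y') .S ∧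
      -- new in this car
      k₁ ≤ ω.2.firstHitG ∧ (∀ j < k₁, arcKind (ω.2.sIn j) (ω.2.sOut j) = .straight) ∧ arcKind (ω.2.sIn k₁) (ω.2.sOut k₁) ≠ .straight ∧
      ω.2.fc k₁ = (w.1 + k₁, w.2) ∧ ω.2.sIn k₁ = .W ∧ w.1 + k₁ ≤ k₀ ∧
      (∀ x : ℤ, ¬ω.2.UsesSide (x, Y') .S) ∧ ¬ω.2.UsesSide (r.1 - MW, Y') .W ∧ ¬ω.2.UsesSide (k₀, Y') .E ∧ ¬ω.2.UsesSide (k₀, Y') .S ∧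
      ω.2.sIn ω.2.firstHitG = .E ∧ ω.2.sOut ω.2.firstHitG = .W ∧
      (∀ m : ℕ, m ≤ MW → ω.2.fc (ω.2.firstHitG + m) = (r.1 - m, r.2) ∧ ω.2.sIn (ω.2.firstHitG + m) = .E) ∧
      (∀ m : ℕ, 1 ≤ m → (m : ℤ) ≤ r.2 - Y' → ω.2.fc (ω.2.firstHitG + MW + m) = (r.1 - MW, r.2 - m) ∧ ω.2.sIn (ω.2.firstHitG + MW + m) = .N) ∧
      (∀ m : ℕ, 1 ≤ m → (m : ℤ) ≤ k₀ - (r.1 - MW) →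
        ω.2.fc (ω.2.firstHitG + MW + (r.2 - Y').toNat + m) = (r.1 - MW + m, Y') ∧ ω.2.sIn (ω.2.firstHitG + MW + (r.2 - Y').toNat + m) = .W) ∧
      (∀ m : ℕ, 1 ≤ m → (m : ℤ) ≤ w.2 - Y' →
        ω.2.fc (ω.2.firstHitG + MW + (r.2 - Y').toNat + (k₀ - (r.1 - MW)).toNat + m) = (k₀, Y' + m) ∧
          ω.2.sIn (ω.2.firstHitG + MW + (r.2 - Y').toNat + (k₀ - (r.1 - MW)).toNat + m) = .S) ∧
      ω.2.firstHitG + MW + (r.2 - Y').toNat + (k₀ - (r.1 - MW)).toNat + (w.2 - Y').toNat < ω.2.arcs.length := by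
  classical
  set n := ω.2.arcs.length with hn
  ---------------------------------------------------------------- basics
  have hF := ω.fh_lt h
  have hlen : 0 < n := by omega
  have h0w : ω.2.fc 0 = w := fc_zero_eq_root w hh ω.2 hlen
  have h0W : ω.2.sIn 0 = .W := YBWalk.sIn_zero_eq_W hh ω.2 hlen
  have h0E : ω.2.sIn 0 ≠ .E := by rw [h0W]; decide
  have h0N : ω.2.sIn 0 ≠ .N := by rw [h0W]; decide
  have h0S : ω.2.sIn 0 ≠ .S := by rw [h0W]; decide
  have hfcF := (fc_fh ω hr h).1
  have hsvr : ∀ l < n, ω.2.fc l = ω.2.fc ω.2.firstHitG → l = ω.2.firstHitG := fun l hl e => eq_firstHitG_of_fc_eq hr h hl e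
  have hn1 : n - 1 < n := by omega
  have hwr : r.1 < w.1 := by omega
  ---------------------------------------------------------------- the west leg (car 41) with the seven turns
  obtain ⟨Y, Y', τ1, MW, ME, t₂, b₂, hY, hY', hr₃, hY'w, ht₂row, ht₂col, hb₂row, hb₂col, hτ1w, hMW1, hME1, hEW, hWW, hnotW, hWE, hEE, hnotE,
    hseven, hall, hN1, hL, hLS, hdesc, hdescIn, heWS, heWnN, hlegN, hlegS, hbWnS⟩ :=
    westLeg_of_cost_seven_straight_holeColumn_above hh hr h hA hc hz hstr8 hcol habove hup
  let P : Face → Prop := fun f => f ∈ facesL ω.2.mids ∧ (kindsL ω.2.mids f = [.corner] ∨ kindsL ω.2.mids f = [.coCorner])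
  have hPiso : ∀ k < n, (∀ l < n, ω.2.fc l = ω.2.fc k → l = k) → arcKind (ω.2.sIn k) (ω.2.sOut k) ≠ .straight → P (ω.2.fc k) :=
    fun k hk hsv hkind => isolated_turn hk hsv hkind
  have hmem7 : ∀ f : Face, P f → f = ((r.1 : ℤ), Y) ∨ f = t₂ ∨ f = ((r.1 : ℤ) - MW, Y') ∨ f = b₂ ∨ f = ((τ1 : ℤ), w.2) ∨
      f = ((r.1 : ℤ) - MW, r.2) ∨ f = ((r.1 : ℤ) + ME, r.2) := by
    intro f hPf
    have := hall f hPf.1 hPf.2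
    simpa only [Finset.mem_insert, Finset.mem_singleton] using this
  have hP7 : ∀ f : Face, (f = ((r.1 : ℤ), Y) ∨ f = t₂ ∨ f = ((r.1 : ℤ) - MW, Y') ∨ f = b₂ ∨ f = ((τ1 : ℤ), w.2) ∨
      f = ((r.1 : ℤ) - MW, r.2) ∨ f = ((r.1 : ℤ) + ME, r.2)) → P f := by
    intro f hf
    apply hseven
    simpa only [Finset.mem_insert, Finset.mem_singleton] using hf
  have hProw : ∀ f : Face, P f → f.2 = Y ∨ f.2 = Y' ∨ f.2 = w.2 ∨ f.2 = r.2 := by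
    intro f hPf
    rcases hmem7 f hPf with rfl | rfl | rfl | rfl | rfl | rfl | rfl
    · exact Or.inl rfl
    · exact Or.inl ht₂row
    · exact Or.inr (Or.inl rfl)
    · exact Or.inr (Or.inl hb₂row)
    · exact Or.inr (Or.inr (Or.inl rfl))
    · exact Or.inr (Or.inr (Or.inr rfl))
    · exact Or.inr (Or.inr (Or.inr rfl))
  have hbots : ∀ f : Face, P f → f.2 = Y' → f = ((r.1 : ℤ) - MW, Y') ∨ f = b₂ := by
    intro f hPf hfY
    rcases hmem7 f hPf with e | e | e | e | e | e | e
    · exfalso; rw [e] at hfY; simp only at hfY; omega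
    · exfalso; rw [e, ht₂row] at hfY; omega
    · exact Or.inl e
    · exact Or.inr e
    · exfalso; rw [e] at hfY; simp only at hfY; omega
    · exfalso; rw [e] at hfY; simp only at hfY; omega
    · exfalso; rw [e] at hfY; simp only at hfY; omega
  obtain ⟨X', -, hX', -⟩ := exists_right_entry_turn hh hr h
  obtain ⟨X, hXw, hX, -⟩ := exists_left_entry_turn hh hr h hA
  ---------------------------------------------------------------- rows: a plaquette using `E` or `W` lies on one of the four turn rows
  have hrowE : ∀ c : Face, ω.2.UsesSide c .E → c.2 = Y ∨ c.2 = Y' ∨ c.2 = w.2 ∨ c.2 = r.2 := by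
    intro c hcE
    obtain ⟨M, hWall, -, hend⟩ := ω.2.chain_E hX' hcE
    rcases hend with ⟨hM1, hnot⟩ | ⟨-, hs0⟩ | ⟨-, hsZ⟩
    · obtain ⟨i', hi', hfc', hsv', -, -, -, hk'⟩ := ω.2.isolated_of_usesSide_not_opp (hWall M hM1 le_rfl) hnot
      have hP' : P (c.1 + M, c.2) := by rw [← hfc']; exact hPiso i' hi' hsv' hk'
      have := hProw _ hP'; simp only at this; exact this
    · exact absurd hs0 h0E
    · rw [hLS] at hsZ; exact absurd hsZ (by decide)
  have hrowW : ∀ c : Face, ω.2.UsesSide c .W → c.2 = Y ∨ c.2 = Y' ∨ c.2 = w.2 ∨ c.2 = r.2 := by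
    intro c hcW
    obtain ⟨M, hEall, -, hend⟩ := ω.2.chain_W hX hcW
    rcases hend with ⟨hM1, hnot⟩ | ⟨hA0, -⟩ | ⟨-, hsZ⟩
    · obtain ⟨i', hi', hfc', hsv', -, -, -, hk'⟩ := ω.2.isolated_of_usesSide_not_opp (hEall M hM1 le_rfl) hnot
      have hP' : P (c.1 - M, c.2) := by rw [← hfc']; exact hPiso i' hi' hsv' hk'
      have := hProw _ hP'; simp only at this; exact this
    · rw [h0w] at hA0; have := congrArg Prod.snd hA0; simp only at this; exact Or.inr (Or.inr (Or.inl this))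
    · rw [hLS] at hsZ; exact absurd hsZ (by decide)
  have hvert : ∀ i < n, (ω.2.fc i).2 ≠ Y → (ω.2.fc i).2 ≠ Y' → (ω.2.fc i).2 ≠ w.2 → (ω.2.fc i).2 ≠ r.2 →
      arcKind (ω.2.sIn i) (ω.2.sOut i) = .straight := by
    intro i hi h1 h2 h3 h4
    have hnot : ¬(ω.2.UsesSide (ω.2.fc i) .E ∨ ω.2.UsesSide (ω.2.fc i) .W) := by
      rintro (hu | hu)
      · rcases hrowE _ hu with e | e | e | e
        · exact h1 e
        · exact h2 e
        · exact h3 e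
        · exact h4 e
      · rcases hrowW _ hu with e | e | e | e
        · exact h1 e
        · exact h2 e
        · exact h3 e
        · exact h4 e
    have hiE : ω.2.sIn i ≠ .E := fun e => hnot (Or.inl ⟨i, hi, rfl, Or.inl e⟩)
    have hoE : ω.2.sOut i ≠ .E := fun e => hnot (Or.inl ⟨i, hi, rfl, Or.inr e⟩)
    have hiW : ω.2.sIn i ≠ .W := fun e => hnot (Or.inr ⟨i, hi, rfl, Or.inl e⟩)
    have hoW : ω.2.sOut i ≠ .W := fun e => hnot (Or.inr ⟨i, hi, rfl, Or.inr e⟩)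
    have hne := ω.2.sIn_ne_sOut hi
    revert hiE hoE hiW hoW hne
    cases ω.2.sIn i <;> cases ω.2.sOut i <;> decide
  ---------------------------------------------------------------- the first turning arc `k₁` and the root-row plaquette `q = (k₀, w.2)` met by the excursion from below
  have hexk : ∃ k, k < n ∧ arcKind (ω.2.sIn k) (ω.2.sOut k) ≠ .straight := by
    by_contra hnone
    push Not at hnone
    obtain ⟨hrun0, -⟩ := ω.2.initial_run hh hF (fun i hi => hnone i (by omega))
    have e := (hrun0 ω.2.firstHitG le_rfl).1
    rw [hfcF] at e
    have := congrArg Prod.snd e; simp only at this; omega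
  obtain ⟨hk₁, hk₁ns⟩ := Nat.find_spec hexk
  set k₁ := Nat.find hexk with hk₁def
  have hstr : ∀ i < k₁, arcKind (ω.2.sIn i) (ω.2.sOut i) = .straight := by
    intro i hi; by_contra hne; exact Nat.find_min hexk hi ⟨by omega, hne⟩
  obtain ⟨hrun, -⟩ := ω.2.initial_run hh hk₁ hstr
  obtain ⟨hfk, hWk⟩ := hrun k₁ le_rfl
  have hk₁F : k₁ ≤ ω.2.firstHitG := by
    by_contra hlt
    push Not at hlt
    obtain ⟨hrun0, -⟩ := ω.2.initial_run hh hF (fun i hi => hstr i (by omega))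
    have e := (hrun0 ω.2.firstHitG le_rfl).1
    rw [hfcF] at e
    have := congrArg Prod.snd e; simp only at this; omega
  obtain ⟨i, hFi, hin, hki, hrow, hS⟩ := exists_tail_arc_rootRow_S_beyond_prefix hh hr h hA hwr hk₁F hstr
  set k₀ : ℤ := (ω.2.fc i).1 with hk₀def
  have hfci : ω.2.fc i = (k₀, w.2) := Prod.ext rfl hrow
  have hk₀w : w.1 + k₁ ≤ k₀ := hki
  -- the `S`-chain of `q` ends at the second bottom turn `b₂ = (k₀, Y')`
  have hqS : ω.2.UsesSide (k₀, w.2) .S := ⟨i, hin, hfci, hS⟩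
  obtain ⟨M₀, hNq, hSq, hendq⟩ := ω.2.chain_S hY' hqS
  simp only at hNq hSq hendq
  obtain ⟨hM₀, hb₂eq, hbEnS⟩ : (M₀ : ℤ) = w.2 - Y' ∧ b₂ = (k₀, Y') ∧ ¬ω.2.UsesSide (k₀, Y') .S := by
    rcases hendq with ⟨hM1, hnot⟩ | ⟨-, hs0⟩ | ⟨hZ, -⟩
    · obtain ⟨i', hi', hfc', hsv', -, -, -, hk'⟩ := ω.2.isolated_of_usesSide_not_opp (hNq M₀ hM1 le_rfl) hnot
      have hP' : P (k₀, w.2 - M₀) := by rw [← hfc']; exact hPiso i' hi' hsv' hk'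
      have hrow' : (((k₀, w.2 - M₀) : Face)).2 = Y' := by
        rcases hProw _ hP' with e | e | e | e <;> simp only at e ⊢ <;> omega
      simp only at hrow'
      have ecell : (((k₀, w.2 - M₀) : Face)) = (k₀, Y') := Prod.ext rfl (by simp only; omega)
      rw [ecell] at hP' hnot
      rcases hbots _ hP' rfl with e | e
      · exfalso; have := congrArg Prod.fst e; simp only at this; omega
      · exact ⟨by omega, e.symm, hnot⟩
    · exact absurd hs0 h0S
    · rw [hL] at hZ; have := congrArg Prod.fst hZ; simp only at this; omega
  subst hb₂eq
  simp only at hb₂col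
  ---------------------------------------------------------------- the bottom row between `b_W` and `b_E`
  have hbotS : ∀ x : ℤ, ¬ω.2.UsesSide (x, Y') .S := by
    intro x hu
    rcases ω.2.usesSide_step_S hu with ⟨e, hs⟩ | ⟨e, -⟩ | hN
    · exact h0S hs
    · rw [hL] at e; have := congrArg Prod.snd e; simp only at this; omega
    · obtain ⟨j, hj, hfj⟩ := ω.2.exists_fc_eq_of_usesSide hN
      have := hY' j hj; rw [hfj] at this; simp only at this; omega
  have hbEnE : ¬ω.2.UsesSide (k₀, Y') .E := by
    intro hu
    obtain ⟨M, hWall, -, hend⟩ := ω.2.chain_E hX' hu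
    simp only at hWall hend
    rcases hend with ⟨hM1, hnot⟩ | ⟨-, hs0⟩ | ⟨-, hsZ⟩
    · obtain ⟨i', hi', hfc', hsv', -, -, -, hk'⟩ := ω.2.isolated_of_usesSide_not_opp (hWall M hM1 le_rfl) hnot
      have hP' : P (k₀ + M, Y') := by rw [← hfc']; exact hPiso i' hi' hsv' hk'
      rcases hbots _ hP' rfl with e | e
      · have := congrArg Prod.fst e; simp only at this; omega
      · have := congrArg Prod.fst e; simp only at this; omega
    · exact h0E hs0
    · rw [hLS] at hsZ; exact absurd hsZ (by decide)
  have hbWnW : ¬ω.2.UsesSide ((r.1 : ℤ) - MW, Y') .W := by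
    intro hu
    obtain ⟨M, hEall, -, hend⟩ := ω.2.chain_W hX hu
    simp only at hEall hend
    rcases hend with ⟨hM1, hnot⟩ | ⟨hA0, -⟩ | ⟨-, hsZ⟩
    · obtain ⟨i', hi', hfc', hsv', -, -, -, hk'⟩ := ω.2.isolated_of_usesSide_not_opp (hEall M hM1 le_rfl) hnot
      have hP' : P ((r.1 : ℤ) - MW - M, Y') := by rw [← hfc']; exact hPiso i' hi' hsv' hk'
      rcases hbots _ hP' rfl with e | e
      · have := congrArg Prod.fst e; simp only at this; omega
      · have := congrArg Prod.fst e; simp only at this; omega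
    · rw [h0w] at hA0; have := congrArg Prod.snd hA0; simp only at this; omega
    · rw [hLS] at hsZ; exact absurd hsZ (by decide)
  -- `b_E` uses `N` and `W`; its `W`-chain runs to `b_W`
  have hbEN : ω.2.UsesSide (k₀, Y') .N := by
    have := hNq M₀ (by omega) le_rfl
    rwa [show w.2 - (M₀ : ℤ) = Y' by omega] at this
  have hbEW : ω.2.UsesSide (k₀, Y') .W := by
    obtain ⟨j, hj, hfj, hsN⟩ := hbEN
    refine ⟨j, hj, hfj, ?_⟩
    have hne := ω.2.sIn_ne_sOut hj
    have hnS1 : ω.2.sIn j ≠ .S := fun e => hbEnS ⟨j, hj, hfj, Or.inl e⟩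
    have hnS2 : ω.2.sOut j ≠ .S := fun e => hbEnS ⟨j, hj, hfj, Or.inr e⟩
    have hnE1 : ω.2.sIn j ≠ .E := fun e => hbEnE ⟨j, hj, hfj, Or.inl e⟩
    have hnE2 : ω.2.sOut j ≠ .E := fun e => hbEnE ⟨j, hj, hfj, Or.inr e⟩
    revert hsN hne hnS1 hnS2 hnE1 hnE2
    cases ω.2.sIn j <;> cases ω.2.sOut j <;> decide
  obtain ⟨M₁, hbE1, hbW1, hend1⟩ := ω.2.chain_W hX hbEW
  simp only at hbE1 hbW1 hend1
  have hM₁ : (M₁ : ℤ) = k₀ - (r.1 - MW) := by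
    rcases hend1 with ⟨hM1, hnot⟩ | ⟨hA0, -⟩ | ⟨-, hsZ⟩
    · obtain ⟨i', hi', hfc', hsv', -, -, -, hk'⟩ := ω.2.isolated_of_usesSide_not_opp (hbE1 M₁ hM1 le_rfl) hnot
      have hP' : P (k₀ - M₁, Y') := by rw [← hfc']; exact hPiso i' hi' hsv' hk'
      rcases hbots _ hP' rfl with e | e
      · have := congrArg Prod.fst e; simp only at this; omega
      · have := congrArg Prod.fst e; simp only at this; omega
    · rw [h0w] at hA0; have := congrArg Prod.snd hA0; simp only at this; omega
    · rw [hLS] at hsZ; exact absurd hsZ (by decide)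
  have hbotStraight : ∀ x : ℤ, r.1 - MW < x → x < k₀ → ∀ l < n, ω.2.fc l = (x, Y') → arcKind (ω.2.sIn l) (ω.2.sOut l) = .straight := by
    intro x hx1 hx2 l hl hfl
    obtain ⟨m, hm⟩ : ∃ m : ℕ, (m : ℤ) = k₀ - x := ⟨(k₀ - x).toNat, by omega⟩
    have hcE : ω.2.UsesSide (x, Y') .E := by have := hbE1 m (by omega) (by omega); rwa [show k₀ - (m : ℤ) = x by omega] at this
    have hcW : ω.2.UsesSide (x, Y') .W := by have := hbW1 m (by omega); rwa [show k₀ - (m : ℤ) = x by omega] at this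
    exact ω.2.straight_of_usesSide_EW hcE hcW (hbotS x) l hl hfl
  ---------------------------------------------------------------- the two legs and the row of `r` carry straight cells
  -- the root-row plaquette of the west leg, `(r.1 − MW, w.2)`, uses neither `E` nor `W` (its chain would run into the absent hole)
  have hmemD : ∀ {c : Face} {s : Side}, ω.2.UsesSide c s → c ∈ D := by
    intro c s hu
    obtain ⟨j, hj, hfj⟩ := ω.2.exists_fc_eq_of_usesSide hu
    rw [← hfj]; exact (YBWalk.arcFace_arcAt hj).2
  have hlegWE : ¬ω.2.UsesSide ((r.1 : ℤ) - MW, w.2) .E := by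
    intro hu
    obtain ⟨M, hWall, -, hend⟩ := ω.2.chain_E hX' hu
    simp only at hWall hend
    have hMbig : (MW : ℤ) ≤ M := by
      rcases hend with ⟨hM1, hnot⟩ | ⟨hA0, -⟩ | ⟨hZ, -⟩
      · obtain ⟨i', hi', hfc', hsv', -, -, -, hk'⟩ := ω.2.isolated_of_usesSide_not_opp (hWall M hM1 le_rfl) hnot
        have hP' : P ((r.1 : ℤ) - MW + M, w.2) := by rw [← hfc']; exact hPiso i' hi' hsv' hk'
        rcases hmem7 _ hP' with e | e | e | e | e | e | e
        · have := congrArg Prod.snd e; simp only at this; omega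
        · have := congrArg Prod.snd e; rw [ht₂row] at this; simp only at this; omega
        · have := congrArg Prod.snd e; simp only at this; omega
        · have := congrArg Prod.snd e; simp only at this; omega
        · have := congrArg Prod.fst e; simp only at this; omega
        · have := congrArg Prod.snd e; simp only at this; omega
        · have := congrArg Prod.snd e; simp only at this; omega
      · rw [h0w] at hA0; have := congrArg Prod.fst hA0; simp only at this; omega
      · rw [hL] at hZ; have := congrArg Prod.snd hZ; simp only at this; omega
    have hhole := hmemD (hWall MW hMW1 (by exact_mod_cast hMbig))
    rw [show (r.1 : ℤ) - MW + MW = r.1 by ring] at hhole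
    exact hh (by rw [show holeFaceW w = (r.1, w.2) from Prod.ext (by simp [holeFaceW]; omega) (by simp [holeFaceW])]; exact hhole)
  have hlegWW : ¬ω.2.UsesSide ((r.1 : ℤ) - MW, w.2) .W := by
    intro hu
    obtain ⟨M, hEall, -, hend⟩ := ω.2.chain_W hX hu
    simp only at hEall hend
    rcases hend with ⟨hM1, hnot⟩ | ⟨hA0, -⟩ | ⟨-, hsZ⟩
    · obtain ⟨i', hi', hfc', hsv', -, -, -, hk'⟩ := ω.2.isolated_of_usesSide_not_opp (hEall M hM1 le_rfl) hnot
      have hP' : P ((r.1 : ℤ) - MW - M, w.2) := by rw [← hfc']; exact hPiso i' hi' hsv' hk'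
      rcases hmem7 _ hP' with e | e | e | e | e | e | e
      · have := congrArg Prod.snd e; simp only at this; omega
      · have := congrArg Prod.snd e; rw [ht₂row] at this; simp only at this; omega
      · have := congrArg Prod.snd e; simp only at this; omega
      · have := congrArg Prod.snd e; simp only at this; omega
      · have := congrArg Prod.fst e; simp only at this; omega
      · have := congrArg Prod.snd e; simp only at this; omega
      · have := congrArg Prod.snd e; simp only at this; omega
    · rw [h0w] at hA0; have := congrArg Prod.fst hA0; simp only at this; omega
    · rw [hLS] at hsZ; exact absurd hsZ (by decide)
  have hlegStraight : ∀ y : ℤ, Y' < y → y < r.2 → ∀ l < n, ω.2.fc l = ((r.1 : ℤ) - MW, y) → arcKind (ω.2.sIn l) (ω.2.sOut l) = .straight := by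
    intro y hy1 hy2 l hl hfl
    by_cases hyw : y = w.2
    · subst hyw
      obtain ⟨m, hm⟩ : ∃ m : ℕ, (m : ℤ) = r.2 - w.2 := ⟨(r.2 - w.2).toNat, by omega⟩
      have hcN : ω.2.UsesSide ((r.1 : ℤ) - MW, w.2) .N := by
        have := hlegN m (by omega) (by omega); rwa [show r.2 - (m : ℤ) = w.2 by omega] at this
      have hcS : ω.2.UsesSide ((r.1 : ℤ) - MW, w.2) .S := by
        have := hlegS m (by omega); rwa [show r.2 - (m : ℤ) = w.2 by omega] at this
      exact ω.2.straight_of_usesSide_NS hcN hcS hlegWE l hl hfl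
    · exact hvert l hl (by rw [hfl]; simp only; omega) (by rw [hfl]; simp only; omega) (by rw [hfl]; simp only; exact hyw)
        (by rw [hfl]; simp only; omega)
  have hlegEStraight : ∀ y : ℤ, Y' < y → y < w.2 → ∀ l < n, ω.2.fc l = (k₀, y) → arcKind (ω.2.sIn l) (ω.2.sOut l) = .straight := by
    intro y hy1 hy2 l hl hfl
    exact hvert l hl (by rw [hfl]; simp only; omega) (by rw [hfl]; simp only; omega) (by rw [hfl]; simp only; omega)
      (by rw [hfl]; simp only; omega)
  have hrowStraight : ∀ m : ℕ, 1 ≤ m → m < MW → ∀ l < n, ω.2.fc l = ((r.1 : ℤ) - m, r.2) → arcKind (ω.2.sIn l) (ω.2.sOut l) = .straight := by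
    intro m hm1 hmM l hl hfl
    have hcS : ¬ω.2.UsesSide ((r.1 : ℤ) - m, r.2) .S := by
      intro hu
      obtain ⟨M, hNall, -, hend⟩ := ω.2.chain_S hY' hu
      simp only at hNall hend
      rcases hend with ⟨hM1, hnot⟩ | ⟨hA0, -⟩ | ⟨hZ, -⟩
      · obtain ⟨i', hi', hfc', hsv', -, -, -, hk'⟩ := ω.2.isolated_of_usesSide_not_opp (hNall M hM1 le_rfl) hnot
        have hP' : P ((r.1 : ℤ) - m, r.2 - M) := by rw [← hfc']; exact hPiso i' hi' hsv' hk'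
        rcases hmem7 _ hP' with e | e | e | e | e | e | e
        · have := congrArg Prod.snd e; simp only at this; omega
        · have := congrArg Prod.snd e; rw [ht₂row] at this; simp only at this; omega
        · have := congrArg Prod.fst e; simp only at this; omega
        · have := congrArg Prod.fst e; simp only at this; omega
        · have := congrArg Prod.fst e; simp only at this; omega
        · have := congrArg Prod.snd e; simp only at this; omega
        · have := congrArg Prod.snd e; simp only at this; omega
      · rw [h0w] at hA0; have := congrArg Prod.fst hA0; simp only at this; omega
      · rw [hL] at hZ; have := congrArg Prod.fst hZ; simp only at this; omega
    exact ω.2.straight_of_usesSide_EW (hEW m hm1 (by omega)) (hWW m hmM) hcS l hl hfl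
  -- `e_W` is singly visited, its arc uses `E` and `S`
  have hsvW : ∀ i j, i < n → j < n → ω.2.fc i = ((r.1 : ℤ) - MW, r.2) → ω.2.fc j = ((r.1 : ℤ) - MW, r.2) → i = j :=
    fun i j hi hj hci hcj => ω.2.single_visit_of_not_usesSide hnotW hi hj hci hcj
  obtain ⟨dB, hdB⟩ : ∃ dB : ℕ, (dB : ℤ) = w.2 - Y' - 1 := ⟨(w.2 - Y' - 1).toNat, by omega⟩
  obtain ⟨dR, hdR⟩ : ∃ dR : ℕ, (dR : ℤ) = k₀ - (r.1 - MW) - 1 := ⟨(k₀ - (r.1 - MW) - 1).toNat, by omega⟩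
  obtain ⟨dL, hdL⟩ : ∃ dL : ℕ, (dL : ℤ) = r.2 - Y' - 1 := ⟨(r.2 - Y' - 1).toNat, by omega⟩
  ---------------------------------------------------------------- the excursion arc at `q` cannot LEAVE through `S`
  have hSin : ω.2.sIn i = .S := by
    rcases hS with hS | hS
    · exact hS
    exfalso
    -- down the column `k₀`
    have hcellsD : ∀ m : ℕ, 1 ≤ m → m ≤ dB → ∀ l < n, ω.2.fc l = ((ω.2.fc i).1, (ω.2.fc i).2 - m) → arcKind (ω.2.sIn l) (ω.2.sOut l) = .straight := by
      intro m hm1 hmM l hl hfl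
      rw [hfci] at hfl; exact hlegEStraight _ (by omega) (by omega) l hl hfl
    have hiB : i + dB + 1 < n := by
      by_contra hge
      obtain ⟨e, -⟩ := ω.2.run_down_of_straight (j := i) (M := n - 1 - i) (by omega) hS (fun m hm1 hmM l hl hfl => hcellsD m hm1 (by omega) l hl hfl)
        (n - 1 - i) le_rfl
      rw [show i + (n - 1 - i) = n - 1 by omega, hL, hfci] at e
      have := congrArg Prod.fst e; simp only at this; omega
    have hrunD := ω.2.run_down_of_straight (j := i) (M := dB) (by omega) hS hcellsD
    obtain ⟨hfcD, houtD⟩ := hrunD dB le_rfl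
    rw [hfci] at hfcD
    have hfcB := ω.2.fc_succ_eq_of_sOut_S hiB houtD
    have hinB := sIn_succ_eq_N ω.2 hiB houtD
    rw [hfcD] at hfcB; simp only at hfcB
    have hfcB' : ω.2.fc (i + dB + 1) = (k₀, Y') := by rw [hfcB]; exact Prod.ext rfl (by simp only; omega)
    -- west along the bottom row
    have houtB : ω.2.sOut (i + dB + 1) = .W := by
      have hne := ω.2.sIn_ne_sOut hiB
      rw [hinB] at hne
      have hnS : ω.2.sOut (i + dB + 1) ≠ .S := fun e => hbEnS ⟨_, hiB, hfcB', Or.inr e⟩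
      have hnE : ω.2.sOut (i + dB + 1) ≠ .E := fun e => hbEnE ⟨_, hiB, hfcB', Or.inr e⟩
      revert hne hnS hnE; cases ω.2.sOut (i + dB + 1) <;> decide
    have hcellsW : ∀ m : ℕ, 1 ≤ m → m ≤ dR → ∀ l < n, ω.2.fc l = ((ω.2.fc (i + dB + 1)).1 - m, (ω.2.fc (i + dB + 1)).2) →
        arcKind (ω.2.sIn l) (ω.2.sOut l) = .straight := by
      intro m hm1 hmM l hl hfl
      rw [hfcB'] at hfl; exact hbotStraight _ (by simp only; omega) (by simp only; omega) l hl hfl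
    have hiW : i + dB + 1 + dR + 1 < n := by
      by_contra hge
      obtain ⟨e, -⟩ := ω.2.run_west_of_straight (j := i + dB + 1) (M := n - 1 - (i + dB + 1)) (by omega) houtB
        (fun m hm1 hmM l hl hfl => hcellsW m hm1 (by omega) l hl hfl) (n - 1 - (i + dB + 1)) le_rfl
      rw [show i + dB + 1 + (n - 1 - (i + dB + 1)) = n - 1 by omega, hL, hfcB'] at e
      have := congrArg Prod.snd e; simp only at this; omega
    have hrunW := ω.2.run_west_of_straight (j := i + dB + 1) (M := dR) (by omega) houtB hcellsW
    obtain ⟨hfcR, houtR⟩ := hrunW dR le_rfl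
    rw [hfcB'] at hfcR
    obtain ⟨hfcBW, hinBW⟩ := ω.2.fc_succ_eq_of_sOut_W hiW houtR
    rw [hfcR] at hfcBW; simp only at hfcBW
    have hfcBW' : ω.2.fc (i + dB + 1 + dR + 1) = ((r.1 : ℤ) - MW, Y') := by rw [hfcBW]; exact Prod.ext (by simp only; omega) rfl
    -- up the west leg into `e_W` from `S`
    have houtBW : ω.2.sOut (i + dB + 1 + dR + 1) = .N := by
      have hne := ω.2.sIn_ne_sOut hiW
      rw [hinBW] at hne
      have hnS : ω.2.sOut (i + dB + 1 + dR + 1) ≠ .S := fun e => hbWnS ⟨_, hiW, hfcBW', Or.inr e⟩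
      have hnW : ω.2.sOut (i + dB + 1 + dR + 1) ≠ .W := fun e => hbWnW ⟨_, hiW, hfcBW', Or.inr e⟩
      revert hne hnS hnW; cases ω.2.sOut (i + dB + 1 + dR + 1) <;> decide
    have hcellsU : ∀ m : ℕ, 1 ≤ m → m ≤ dL → ∀ l < n, ω.2.fc l = ((ω.2.fc (i + dB + 1 + dR + 1)).1, (ω.2.fc (i + dB + 1 + dR + 1)).2 + m) →
        arcKind (ω.2.sIn l) (ω.2.sOut l) = .straight := by
      intro m hm1 hmM l hl hfl
      rw [hfcBW'] at hfl; exact hlegStraight _ (by omega) (by omega) l hl hfl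
    have hiU : i + dB + 1 + dR + 1 + dL + 1 < n := by
      by_contra hge
      obtain ⟨e, -⟩ := ω.2.run_up_of_straight (j := i + dB + 1 + dR + 1) (M := n - 1 - (i + dB + 1 + dR + 1)) (by omega) houtBW
        (fun m hm1 hmM l hl hfl => hcellsU m hm1 (by omega) l hl hfl) (n - 1 - (i + dB + 1 + dR + 1)) le_rfl
      rw [show i + dB + 1 + dR + 1 + (n - 1 - (i + dB + 1 + dR + 1)) = n - 1 by omega, hL, hfcBW'] at e
      have := congrArg Prod.fst e; simp only at this; omega
    have hrunU := ω.2.run_up_of_straight (j := i + dB + 1 + dR + 1) (M := dL) (by omega) houtBW hcellsU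
    obtain ⟨hfcU, houtU⟩ := hrunU dL le_rfl
    rw [hfcBW'] at hfcU
    have hfcEW := ω.2.fc_succ_eq_of_sOut_N hiU houtU
    have hinEW := sIn_succ_eq_S ω.2 hiU houtU
    rw [hfcU] at hfcEW; simp only at hfcEW
    have hfcEW' : ω.2.fc (i + dB + 1 + dR + 1 + dL + 1) = ((r.1 : ℤ) - MW, r.2) := by rw [hfcEW]; exact Prod.ext rfl (by simp only; omega)
    -- `e_W` left through `E`, and the row of `r` eastwards back INTO `r`: a second visit of `r`
    have houtEW : ω.2.sOut (i + dB + 1 + dR + 1 + dL + 1) = .E := by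
      have hne := ω.2.sIn_ne_sOut hiU
      rw [hinEW] at hne
      have hnN : ω.2.sOut (i + dB + 1 + dR + 1 + dL + 1) ≠ .N := fun e => heWnN ⟨_, hiU, hfcEW', Or.inr e⟩
      have hnW : ω.2.sOut (i + dB + 1 + dR + 1 + dL + 1) ≠ .W := fun e => hnotW ⟨_, hiU, hfcEW', Or.inr e⟩
      revert hne hnN hnW; cases ω.2.sOut (i + dB + 1 + dR + 1 + dL + 1) <;> decide
    have hcellsE : ∀ m : ℕ, 1 ≤ m → m ≤ MW - 1 → ∀ l < n,
        ω.2.fc l = ((ω.2.fc (i + dB + 1 + dR + 1 + dL + 1)).1 + m, (ω.2.fc (i + dB + 1 + dR + 1 + dL + 1)).2) →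
        arcKind (ω.2.sIn l) (ω.2.sOut l) = .straight := by
      intro m hm1 hmM l hl hfl
      rw [hfcEW'] at hfl; simp only at hfl
      exact hrowStraight (MW - m) (by omega) (by omega) l hl (by rw [hfl]; exact Prod.ext (by simp only; push_cast [Nat.cast_sub (show m ≤ MW by omega)]; ring) rfl)
    have hiE : i + dB + 1 + dR + 1 + dL + 1 + (MW - 1) + 1 < n := by
      by_contra hge
      obtain ⟨e, -⟩ := ω.2.run_east_of_straight (j := i + dB + 1 + dR + 1 + dL + 1) (M := n - 1 - (i + dB + 1 + dR + 1 + dL + 1)) (by omega) houtEW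
        (fun m hm1 hmM l hl hfl => hcellsE m hm1 (by omega) l hl hfl) (n - 1 - (i + dB + 1 + dR + 1 + dL + 1)) le_rfl
      rw [show i + dB + 1 + dR + 1 + dL + 1 + (n - 1 - (i + dB + 1 + dR + 1 + dL + 1)) = n - 1 by omega, hL, hfcEW'] at e
      have := congrArg Prod.snd e; simp only at this; omega
    have hrunE := ω.2.run_east_of_straight (j := i + dB + 1 + dR + 1 + dL + 1) (M := MW - 1) (by omega) houtEW hcellsE
    obtain ⟨hfcE1, houtE1⟩ := hrunE (MW - 1) le_rfl
    rw [hfcEW'] at hfcE1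
    obtain ⟨hfcr, -⟩ := ω.2.fc_succ_eq_of_sOut_E hiE houtE1
    rw [hfcE1] at hfcr; simp only at hfcr
    have hfcr' : ω.2.fc (i + dB + 1 + dR + 1 + dL + 1 + (MW - 1) + 1) = r := by
      rw [hfcr]; exact Prod.ext (by simp only; push_cast [Nat.cast_sub hMW1]; ring) rfl
    have := hsvr _ hiE (hfcr'.trans hfcF.symm)
    omega
  ---------------------------------------------------------------- it ENTERS `q` from `S`: read the loop backwards down to the first hit
  -- down the column `k₀`
  have hcellsD : ∀ m : ℕ, 1 ≤ m → m ≤ dB → ∀ l < n, ω.2.fc l = ((ω.2.fc i).1, (ω.2.fc i).2 - m) → arcKind (ω.2.sIn l) (ω.2.sOut l) = .straight := by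
    intro m hm1 hmM l hl hfl
    rw [hfci] at hfl; exact hlegEStraight _ (by omega) (by omega) l hl hfl
  have hdBi : dB + 1 ≤ i := by
    by_contra hlt
    obtain ⟨e, -⟩ := ω.2.run_back_below_of_straight hin le_rfl hSin (fun m hm1 hmM l hl hfl => hcellsD m hm1 (by omega) l hl hfl) i le_rfl
    rw [Nat.sub_self, h0w, hfci] at e
    have := congrArg Prod.snd e; simp only at this; omega
  have hrunD := ω.2.run_back_below_of_straight hin (show dB ≤ i by omega) hSin hcellsD
  obtain ⟨hfcD, hinD⟩ := hrunD dB le_rfl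
  rw [hfci] at hfcD
  obtain ⟨hfcB, houtB⟩ := fc_sOut_pred_of_sIn_S ω.2 (i := i - dB) (by omega) (by omega) hinD
  rw [hfcD, show i - dB - 1 = i - (dB + 1) by omega] at hfcB; simp only at hfcB
  rw [show i - dB - 1 = i - (dB + 1) by omega] at houtB
  set jE := i - (dB + 1) with hjEdef
  have hjEn : jE < n := by omega
  have hfcB' : ω.2.fc jE = (k₀, Y') := by rw [hfcB]; exact Prod.ext rfl (by simp only; omega)
  -- `b_E` is entered from `W`: west along the bottom row
  have hinB : ω.2.sIn jE = .W := by
    have hne := ω.2.sIn_ne_sOut hjEn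
    rw [houtB] at hne
    have hnS : ω.2.sIn jE ≠ .S := fun e => hbEnS ⟨_, hjEn, hfcB', Or.inl e⟩
    have hnE : ω.2.sIn jE ≠ .E := fun e => hbEnE ⟨_, hjEn, hfcB', Or.inl e⟩
    revert hne hnS hnE; cases ω.2.sIn jE <;> decide
  have hcellsW : ∀ m : ℕ, 1 ≤ m → m ≤ dR → ∀ l < n, ω.2.fc l = ((ω.2.fc jE).1 - m, (ω.2.fc jE).2) →
      arcKind (ω.2.sIn l) (ω.2.sOut l) = .straight := by
    intro m hm1 hmM l hl hfl
    rw [hfcB'] at hfl; exact hbotStraight _ (by simp only; omega) (by simp only; omega) l hl hfl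
  have hdRj : dR + 1 ≤ jE := by
    by_contra hlt
    obtain ⟨e, -⟩ := ω.2.run_back_west_of_straight hjEn le_rfl hinB (fun m hm1 hmM l hl hfl => hcellsW m hm1 (by omega) l hl hfl) jE le_rfl
    rw [Nat.sub_self, h0w, hfcB'] at e
    have := congrArg Prod.snd e; simp only at this; omega
  have hrunW := ω.2.run_back_west_of_straight hjEn (show dR ≤ jE by omega) hinB hcellsW
  obtain ⟨hfcR, hinR⟩ := hrunW dR le_rfl
  rw [hfcB'] at hfcR
  obtain ⟨hfcBW, houtBW⟩ := ω.2.fc_pred_eq_of_sIn_W (by omega) (by omega) hinR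
  rw [hfcR, show jE - dR - 1 = jE - (dR + 1) by omega] at hfcBW; simp only at hfcBW
  rw [show jE - dR - 1 = jE - (dR + 1) by omega] at houtBW
  set jW' := jE - (dR + 1) with hjW'def
  have hjW'n : jW' < n := by omega
  have hfcBW' : ω.2.fc jW' = ((r.1 : ℤ) - MW, Y') := by rw [hfcBW]; exact Prod.ext (by simp only; omega) rfl
  -- `b_W` is entered from `N`: up the west leg
  have hinBW : ω.2.sIn jW' = .N := by
    have hne := ω.2.sIn_ne_sOut hjW'n
    rw [houtBW] at hne
    have hnS : ω.2.sIn jW' ≠ .S := fun e => hbWnS ⟨_, hjW'n, hfcBW', Or.inl e⟩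
    have hnW : ω.2.sIn jW' ≠ .W := fun e => hbWnW ⟨_, hjW'n, hfcBW', Or.inl e⟩
    revert hne hnS hnW; cases ω.2.sIn jW' <;> decide
  have hcellsU : ∀ m : ℕ, 1 ≤ m → m ≤ dL → ∀ l < n, ω.2.fc l = ((ω.2.fc jW').1, (ω.2.fc jW').2 + m) →
      arcKind (ω.2.sIn l) (ω.2.sOut l) = .straight := by
    intro m hm1 hmM l hl hfl
    rw [hfcBW'] at hfl; exact hlegStraight _ (by omega) (by omega) l hl hfl
  have hdLj : dL + 1 ≤ jW' := by
    by_contra hlt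
    obtain ⟨e, -⟩ := ω.2.run_back_above_of_straight hjW'n le_rfl hinBW (fun m hm1 hmM l hl hfl => hcellsU m hm1 (by omega) l hl hfl) jW' le_rfl
    rw [Nat.sub_self, h0w, hfcBW'] at e
    have := congrArg Prod.fst e; simp only at this; omega
  have hrunU := ω.2.run_back_above_of_straight hjW'n (show dL ≤ jW' by omega) hinBW hcellsU
  obtain ⟨hfcU, hinU⟩ := hrunU dL le_rfl
  rw [hfcBW'] at hfcU
  obtain ⟨hfcEW, houtEW⟩ := fc_sOut_pred_of_sIn_N ω.2 (i := jW' - dL) (by omega) (by omega) hinU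
  rw [hfcU, show jW' - dL - 1 = jW' - (dL + 1) by omega] at hfcEW; simp only at hfcEW
  rw [show jW' - dL - 1 = jW' - (dL + 1) by omega] at houtEW
  set jj := jW' - (dL + 1) with hjjdef
  have hjjn : jj < n := by omega
  have hfcEW' : ω.2.fc jj = ((r.1 : ℤ) - MW, r.2) := by rw [hfcEW]; exact Prod.ext rfl (by simp only; omega)
  -- `e_W` is entered from `E`: east along the row of `r` back to the first hit
  have hinEW : ω.2.sIn jj = .E := by
    have hne := ω.2.sIn_ne_sOut hjjn
    rw [houtEW] at hne
    have hnN : ω.2.sIn jj ≠ .N := fun e => heWnN ⟨_, hjjn, hfcEW', Or.inl e⟩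
    have hnW : ω.2.sIn jj ≠ .W := fun e => hnotW ⟨_, hjjn, hfcEW', Or.inl e⟩
    revert hne hnN hnW; cases ω.2.sIn jj <;> decide
  have hcellsE : ∀ m : ℕ, 1 ≤ m → m ≤ MW - 1 → ∀ l < n, ω.2.fc l = ((ω.2.fc jj).1 + m, (ω.2.fc jj).2) →
      arcKind (ω.2.sIn l) (ω.2.sOut l) = .straight := by
    intro m hm1 hmM l hl hfl
    rw [hfcEW'] at hfl; simp only at hfl
    exact hrowStraight (MW - m) (by omega) (by omega) l hl (by rw [hfl]; exact Prod.ext (by simp only; push_cast [Nat.cast_sub (show m ≤ MW by omega)]; ring) rfl)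
  have hMWj : MW ≤ jj := by
    by_contra hlt
    obtain ⟨e, -⟩ := ω.2.run_back_east_of_straight hjjn le_rfl hinEW (fun m hm1 hmM l hl hfl => hcellsE m hm1 (by omega) l hl hfl) jj le_rfl
    rw [Nat.sub_self, h0w, hfcEW'] at e
    have := congrArg Prod.snd e; simp only at this; omega
  have hrunE := ω.2.run_back_east_of_straight hjjn (show MW - 1 ≤ jj by omega) hinEW hcellsE
  obtain ⟨hfcE1, hinE1⟩ := hrunE (MW - 1) le_rfl
  rw [hfcEW'] at hfcE1
  obtain ⟨hfcr, houtr⟩ := ω.2.fc_pred_eq_of_sIn_E (by omega) (by omega) hinE1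
  rw [hfcE1, show jj - (MW - 1) - 1 = jj - MW by omega] at hfcr; simp only at hfcr
  rw [show jj - (MW - 1) - 1 = jj - MW by omega] at houtr
  have hfcr' : ω.2.fc (jj - MW) = r := by
    rw [hfcr]; exact Prod.ext (by simp only; push_cast [Nat.cast_sub hMW1]; ring) rfl
  have hFeq : jj - MW = ω.2.firstHitG := hsvr _ (by omega) (hfcr'.trans hfcF.symm)
  have houtF : ω.2.sOut ω.2.firstHitG = .W := by rw [← hFeq]; exact houtr
  have hinF : ω.2.sIn ω.2.firstHitG = .E := by
    have := ω.2.sOut_of_straight hF hstr8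
    rw [houtF] at this
    revert this; cases ω.2.sIn ω.2.firstHitG <;> decide
  ---------------------------------------------------------------- re-index from the first hit and assemble
  have hjjF : jj = ω.2.firstHitG + MW := by omega
  have hdL' : (r.2 - Y').toNat = dL + 1 := by omega
  have hdR' : (k₀ - (r.1 - MW)).toNat = dR + 1 := by omega
  have hdB' : (w.2 - Y').toNat = dB + 1 := by omega
  refine ⟨Y, Y', τ1, k₀, MW, ME, k₁, t₂, hY, hY', hr₃, hY'w, ht₂row, ht₂col, hτ1w, hMW1, hME1, hEW, hWW, hnotW, hWE, hEE, hnotE, hseven, hall,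
    hN1, hL, hLS, hdesc, hdescIn, heWS, heWnN, hlegN, hlegS, hbWnS, hk₁F, hstr, hk₁ns, hfk, hWk, hk₀w, hbotS, hbWnW, hbEnE, hbEnS, hinF, houtF,
    ?_, ?_, ?_, ?_, ?_⟩
  · -- the row of `r`
    intro m hm
    rcases Nat.eq_zero_or_pos m with h0 | hpos
    · subst h0; simp only [Nat.cast_zero, sub_zero, add_zero]; exact ⟨hfcF.trans (Prod.ext rfl rfl), hinF⟩
    · obtain ⟨e1, e2⟩ := hrunE (MW - m) (by omega)
      rw [show jj - (MW - m) = ω.2.firstHitG + m by omega] at e1 e2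
      rw [hfcEW'] at e1
      refine ⟨?_, e2⟩
      rw [e1]; exact Prod.ext (by simp only; push_cast [Nat.cast_sub (show m ≤ MW by omega)]; ring) rfl
  · -- the west leg
    intro m hm1 hmM
    obtain ⟨e1, e2⟩ := hrunU (dL + 1 - m) (by omega)
    rw [show jW' - (dL + 1 - m) = ω.2.firstHitG + MW + m by omega] at e1 e2
    rw [hfcBW'] at e1
    refine ⟨?_, e2⟩
    rw [e1]; exact Prod.ext rfl (by simp only; push_cast [Nat.cast_sub (show m ≤ dL + 1 by omega)]; omega)
  · -- the bottom row
    intro m hm1 hmM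
    rw [hdL']
    obtain ⟨e1, e2⟩ := hrunW (dR + 1 - m) (by omega)
    rw [show jE - (dR + 1 - m) = ω.2.firstHitG + MW + (dL + 1) + m by omega] at e1 e2
    rw [hfcB'] at e1
    refine ⟨?_, e2⟩
    rw [e1]; exact Prod.ext (by simp only; push_cast [Nat.cast_sub (show m ≤ dR + 1 by omega)]; omega) rfl
  · -- the east leg
    intro m hm1 hmM
    rw [hdL', hdR']
    obtain ⟨e1, e2⟩ := hrunD (dB + 1 - m) (by omega)
    rw [show i - (dB + 1 - m) = ω.2.firstHitG + MW + (dL + 1) + (dR + 1) + m by omega] at e1 e2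
    rw [hfci] at e1
    refine ⟨?_, e2⟩
    rw [e1]; exact Prod.ext rfl (by simp only; push_cast [Nat.cast_sub (show m ≤ dB + 1 by omega)]; omega)
  · rw [hdL', hdR', hdB']; omega

end ΩG

end Literature.Probability.RandomPlanarGeometry.SAW.YangBaxter
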